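import Literature.NumberTheory.Rogawski1990.EndoscopicCentralizerIso          -- ★ §0 `exists_continuousMulEquiv_centralizer_of_isInducing`, `IsLocalNormPair`, `endoEmbLocal`
import Literature.NumberTheory.Automorphic.LocalHermitianFormsRankThree        -- ★ `exists_formCongr_map_eq_smul_antidiag_of_smul_eq` (rank-3 non-split local classification)
import Literature.NumberTheory.Automorphic.LocalUnitaryGroupCongr              -- ★ `cmDatumLocalCongr`, `coe_cmDatumLocalCongr_apply`
import HarnessLib

/-!
# The CENTRAL DOCK `θ : H_v ≃ₜ* Z_{G′_v}(ε)` at a scalar-block element `ε_H = (a·1₂, u)`, `u ≠ a`, of `H_v = U(Φ₂)(L⁺_v) × U(Φ₁)(L⁺_v)`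
# (non-split `v`; Rogawski 1990 §4.3 pp. 42–44, §8.1 Prop. 8.1.3, §14.2 p. 232 (i); Langlands–Shelstad descent §2.4)

Topic `NumberTheory/Rogawski1990`; namespace `Literature.NumberTheory.Rogawski1990`.  THEOREMS ONLY (existence form; no definition, no instance, no notation,
no named fact, no `sorry`).  Cell `pub/hodgecm-mathlib`, ENGINE T1 (crux H413 = `stmt-HodgeConjecture-24833`); floor-1∕2 preparation, count-neutral, for the pay-down line
«N6nsGerm» (`Cruxes/H413/Lines/F0_P3a_N6nsGerm.lean`, stub `stub_N6nsS1`): F0P2-p02 (g8)'s junction census `CENSUS-N6nsS1-junction` (a69e3f7c) §2 binder **B1 «(T-s′) DOCK at the GOOD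
class»**, dealt to F0P2-p06 (g6) by LEAD F0P3a-plan (g9) WORD T8-66 (A); census `CENSUS-B1-CentralDock` (F0P2-p06 (g6)).

THE MATHEMATICS.  At a finite place `v` of `L⁺` NOT split in `L` (`w ∣ v`, `w̄ = w`, so `∏_{w∣v} L_w = L_w` is a field, ★ `LocalRing.isField_of_smul_eq`) and an inner form
`G′ = U(H′)` (`H′` hermitian, `det H′ ≠ 0`), let `ε_H = (a·1₂, u) ∈ H_v` with `u ≠ a` (the `(G,H)`-regular SINGULAR elements of the N6-ns germ analysis: `ι_v(ε_H) = diag(a, u, a)`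
has the repeated eigenvalue `a`).  Then:
* the local classification of rank-3 hermitian forms (★ `exists_formCongr_map_eq_smul_antidiag_of_smul_eq`: `ᵗ(σT)·H′_v·T = a₀·Φ₃,v`) gives the local congruence
  `c_T : U(Φ₃)(L⁺_v) ≃ₜ* U(H′)(L⁺_v)`, `g ↦ T g T⁻¹` (★ `cmDatumLocalCongr`);
* `ε := c_T(ι_v ε_H)` is MATCHED with `ε_H` (★ `IsLocalNormPair` = conjugacy in `GL₃(∏ L_w)`, witnessed by `T`);
* a matrix commuting with `diag(a, u, a)`, `a − u` a unit, has the block pattern `(* 0 *; 0 * 0; * 0 *)` (§1 `pattern_of_commute_diagonal_of_isUnit_sub`, the twin of ★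
  `pattern_of_commute_diag`), so `Z_{U(Φ₃)}(ι_v ε_H) ⊆ range ι_v` (★ `mem_range_endoEmb_iff_apply`) and `Z_{G′_v}(ε) ⊆ range (c_T ∘ ι_v)`;
* ★ §0 `exists_continuousMulEquiv_centralizer_of_isInducing` for the closed embedding `c_T ∘ ι_v` at `ε_H`, whose centraliser in `H_v` is ALL of `H_v` (`a·1₂` is scalar, `U(Φ₁)` is
  commutative), gives **`θ : H_v ≃ₜ* Z_{G′_v}(ε)` with `(θ z).val = T · ι_v(z) · T⁻¹`** and `θ ε_H = ε`.
This is exactly the binder B1 `(ε) (y) (θ) (hθ)` of the (α′) junction `LocalTransferCentralSingularJunctionCM` (F0P2-p02), with `y := T`.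

* §1 (generic, commutative ring `S`): `pattern_of_commute_diagonal_of_isUnit_sub`.
* §2 (CM carriers): `isUnit_sub_of_ne_of_smul_eq` (non-split ⇒ `a ≠ u → IsUnit (a − u)`), `coe_coe_endoEmbLocal_of_fst_eq_smul_one` (`ι_v(ε_H) = diag(a, u, a)`),
  `mem_range_endoEmbLocal_of_mem_centralizer_of_fst_eq_smul_one` (`Z(ι_v ε_H) ⊆ range ι_v`), `mul_comm_of_fst_eq_smul_one` (`ε_H` is central in `H_v`),
  **`exists_centralDock_of_fst_eq_smul_one`** (the head).
HONEST LABEL: HC_CM is proved only modulo the printed citations (2 remaining named inputs hLiu418, h413) until rung 0 closes; this file is linear algebra ∕ topology over ★ modules and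
pays nothing by itself (it discharges binder B1 of the (α′) junction for `stub_N6nsS1`).

## References
* [Rogawski1990] J. D. Rogawski, *Automorphic Representations of Unitary Groups in Three Variables*, Ann. of Math. Stud. 123 (1990), §4.3 pp. 42–44 (centralisers of matching
  elements), §8.1 Prop. 8.1.3 p. 116 (orbital integrals near a `(G,H)`-regular `ε` through `G_ε`), §14.2 p. 232 (i) (local congruence of the inner forms at `v`).
* [LanglandsShelstad1990Descent] R. Langlands, D. Shelstad, *Descent for transfer factors*, The Grothendieck Festschrift II (1990), §2.4 (equisingular descent to the centraliser).
* [PlatonovRapinchuk1994] V. Platonov, A. Rapinchuk, *Algebraic Groups and Number Theory* (1994), §2.3 (local classification of hermitian forms).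
-/

set_option autoImplicit false

noncomputable section

open NumberField IsDedekindDomain Topology
open scoped Matrix MatrixGroups

namespace Literature.NumberTheory.Rogawski1990

open Literature.NumberTheory.Automorphic Literature.NumberTheory.Automorphic.UnitaryGroup

/-! ## §1 A matrix commuting with `diag(a, u, a)`, `a − u` a unit, has the endoscopic block pattern -/

section Pattern

variable {S : Type*} [CommRing S]

/-- **A `3 × 3` matrix commuting with `diag(a, u, a)` has the pattern `(* 0 *; 0 * 0; * 0 *)` when `a − u` is a unit** (entry `(0,1)`: `B₀₁ u = a B₀₁`, etc.).
The twin of ★ `pattern_of_commute_diag` (`diag(1, −1, 1)`, `2` a unit). [cite: Rogawski1990, §4.3 p. 42; §4.8 Case (a) p. 53] -/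
theorem pattern_of_commute_diagonal_of_isUnit_sub {a u : S} (hau : IsUnit (a - u)) {B : Matrix (Fin 3) (Fin 3) S}
    (hB : Commute B !![a, 0, 0; 0, u, 0; 0, 0, a]) :
    B 0 1 = 0 ∧ B 1 0 = 0 ∧ B 1 2 = 0 ∧ B 2 1 = 0 := by
  have hz : ∀ x : S, x * u = a * x → x = 0 := fun x hx => by
    have h' : (a - u) * x = 0 := by rw [sub_mul, mul_comm u x, hx, sub_self]
    exact (hau.mul_right_eq_zero).mp h'
  have hz' : ∀ x : S, x * a = u * x → x = 0 := fun x hx => by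
    have h' : (a - u) * x = 0 := by rw [sub_mul, mul_comm a x, hx, sub_self]
    exact (hau.mul_right_eq_zero).mp h'
  have e := hB.eq
  have e01 := congrFun (congrFun e 0) 1
  have e10 := congrFun (congrFun e 1) 0
  have e12 := congrFun (congrFun e 1) 2
  have e21 := congrFun (congrFun e 2) 1
  simp [Matrix.mul_apply, Fin.sum_univ_three] at e01 e10 e12 e21
  exact ⟨hz _ e01, hz' _ e10, hz' _ e12, hz _ e21⟩

end Pattern

/-! ## §2 The CM carriers at a non-split place -/

section CM

variable (L : Type) [Field L] [NumberField L] [IsCMField L] {H' : Matrix (Fin 3) (Fin 3) L}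
  (v : HeightOneSpectrum (𝓞 ↥(maximalRealSubfield L)))

/-- At a NON-SPLIT place (`w̄ = w`) `∏_{w∣v} L_w` is a field, so distinct elements differ by a unit. [cite: Rogawski1990, §14.2 p. 232] -/
theorem isUnit_sub_of_ne_of_smul_eq (w : PlacesOver L v) (hw : IsCMField.complexConj L • w.1 = w.1) {a u : LocalRing L v} (h : u ≠ a) :
    IsUnit (a - u) := by
  haveI : Algebra.IsQuadraticExtension ↥(maximalRealSubfield L) L := IsCMField.isQuadraticExtension L
  have hF : IsField (LocalRing L v) := LocalRing.isField_of_smul_eq (IsCMField.complexConj L) (IsCMField.complexConj_ne_one L) w hw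
  obtain ⟨b, hb⟩ := hF.mul_inv_cancel (sub_ne_zero.mpr (Ne.symm h))
  exact isUnit_iff_exists_inv.mpr ⟨b, hb⟩

/-- **`ι_v(a·1₂, u) = diag(a, u, a)`** on matrices (★ `coe_endoEmbLocal`, ★ `coe_endoGL_eq`). [cite: Rogawski1990, §4.8 Case (a) p. 53] -/
theorem coe_coe_endoEmbLocal_of_fst_eq_smul_one
    (εH : (cmDatum L 2 (Matrix.of fun i j : Fin 2 => if i.val + j.val + 1 = 2 then (1 : L) else 0)).Local v ×
      (cmDatum L 1 (Matrix.of fun i j : Fin 1 => if i.val + j.val + 1 = 1 then (1 : L) else 0)).Local v)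
    (a : LocalRing L v) (ha : εH.1.val.val = a • 1) :
    (endoEmbLocal L v εH).val.val = !![a, 0, 0; 0, εH.2.val.val 0 0, 0; 0, 0, a] := by
  rw [coe_endoEmbLocal, coe_endoGL_eq]
  have h00 : εH.1.val.val 0 0 = a := by rw [ha]; simp
  have h01 : εH.1.val.val 0 1 = 0 := by rw [ha]; simp
  have h10 : εH.1.val.val 1 0 = 0 := by rw [ha]; simp
  have h11 : εH.1.val.val 1 1 = a := by rw [ha]; simp
  change !![εH.1.val.val 0 0, 0, εH.1.val.val 0 1; 0, εH.2.val.val 0 0, 0; εH.1.val.val 1 0, 0, εH.1.val.val 1 1] = _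
  rw [h00, h01, h10, h11]

/-- **`Z_{U(Φ₃)(L⁺_v)}(ι_v ε_H) ⊆ range ι_v` for `ε_H = (a·1₂, u)`, `u ≠ a`, `v` non-split** (§1 at `diag(a, u, a)` + ★ `mem_range_endoEmb_iff_apply`).
[cite: Rogawski1990, §4.3 p. 42; §8.1 Prop. 8.1.3 p. 116] -/
theorem mem_range_endoEmbLocal_of_mem_centralizer_of_fst_eq_smul_one (w : PlacesOver L v) (hw : IsCMField.complexConj L • w.1 = w.1)
    (εH : (cmDatum L 2 (Matrix.of fun i j : Fin 2 => if i.val + j.val + 1 = 2 then (1 : L) else 0)).Local v ×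
      (cmDatum L 1 (Matrix.of fun i j : Fin 1 => if i.val + j.val + 1 = 1 then (1 : L) else 0)).Local v)
    (a : LocalRing L v) (ha : εH.1.val.val = a • 1) (hu : εH.2.val.val 0 0 ≠ a)
    {g : (cmDatum L 3 (Matrix.of fun i j : Fin 3 => if i.val + j.val + 1 = 3 then (1 : L) else 0)).Local v}
    (hg : g ∈ Subgroup.centralizer ({endoEmbLocal L v εH} : Set _)) :
    g ∈ Set.range (endoEmbLocal L v) := by
  have h1 : g * endoEmbLocal L v εH = endoEmbLocal L v εH * g := Subgroup.mem_centralizer_singleton_iff.mp hg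
  have h2 : g.val.val * (endoEmbLocal L v εH).val.val = (endoEmbLocal L v εH).val.val * g.val.val :=
    congrArg (fun x : (cmDatum L 3 (Matrix.of fun i j : Fin 3 => if i.val + j.val + 1 = 3 then (1 : L) else 0)).Local v => x.val.val) h1
  rw [coe_coe_endoEmbLocal_of_fst_eq_smul_one L v εH a ha] at h2
  exact (mem_range_endoEmb_iff_apply (σ := conjLocal L (IsCMField.complexConj L) v) (h := endoForm_localForm L v) (u := g)).mpr
    (pattern_of_commute_diagonal_of_isUnit_sub (isUnit_sub_of_ne_of_smul_eq L v w hw hu) h2)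

/-- **`ε_H = (a·1₂, u)` is CENTRAL in `H_v`** (`a·1₂` is a scalar matrix; `1 × 1` matrices commute). [cite: Rogawski1990, §4.9 p. 54] -/
theorem mul_comm_of_fst_eq_smul_one
    (εH : (cmDatum L 2 (Matrix.of fun i j : Fin 2 => if i.val + j.val + 1 = 2 then (1 : L) else 0)).Local v ×
      (cmDatum L 1 (Matrix.of fun i j : Fin 1 => if i.val + j.val + 1 = 1 then (1 : L) else 0)).Local v)
    (a : LocalRing L v) (ha : εH.1.val.val = a • 1)
    (z : (cmDatum L 2 (Matrix.of fun i j : Fin 2 => if i.val + j.val + 1 = 2 then (1 : L) else 0)).Local v ×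
      (cmDatum L 1 (Matrix.of fun i j : Fin 1 => if i.val + j.val + 1 = 1 then (1 : L) else 0)).Local v) :
    z * εH = εH * z := by
  refine Prod.ext (Subtype.ext (Units.ext ?_)) (Subtype.ext (Units.ext ?_))
  · change z.1.val.val * εH.1.val.val = εH.1.val.val * z.1.val.val
    rw [ha, Matrix.mul_smul, Matrix.smul_mul, Matrix.mul_one, Matrix.one_mul]
  · change z.2.val.val * εH.2.val.val = εH.2.val.val * z.2.val.val
    ext i j
    fin_cases i; fin_cases j
    simp [Matrix.mul_apply, mul_comm]

/-- **THE CENTRAL DOCK (binder B1 of the (α′) junction).**  At a NON-SPLIT finite place `v` (`w ∣ v`, `w̄ = w`), for `H′` hermitian with `det H′ ≠ 0` and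
`ε_H = (a·1₂, u) ∈ H_v` with `u ≠ a`: there are `ε ∈ G′_v = U(H′)(L⁺_v)` MATCHED with `ε_H` (★ `IsLocalNormPair`), a conjugator `y ∈ GL₃(∏_{w∣v} L_w)` and an isomorphism of
topological groups `θ : H_v ≃ₜ* Z_{G′_v}(ε)` with `θ ε_H = ε` and `(θ z).val = y · ι_v(z) · y⁻¹` for all `z` — the local congruence `U(Φ₃)(L⁺_v) ≅ U(H′)(L⁺_v)` (★ rank-3 local
classification + ★ `cmDatumLocalCongr`) composed with `ι_v`, whose image IS the centraliser of `diag(a, u, a)`.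
[cite: Rogawski1990, §4.3 pp. 42–44; §8.1 Prop. 8.1.3 p. 116; §14.2 p. 232 (i)] [cite: LanglandsShelstad1990Descent, §2.4] -/
theorem exists_centralDock_of_fst_eq_smul_one (w : PlacesOver L v) (hw : IsCMField.complexConj L • w.1 = w.1)
    (hH' : (H'.map (cmConjRingHom L))ᵀ = H') (hdet' : H'.det ≠ 0)
    (εH : (cmDatum L 2 (Matrix.of fun i j : Fin 2 => if i.val + j.val + 1 = 2 then (1 : L) else 0)).Local v ×
      (cmDatum L 1 (Matrix.of fun i j : Fin 1 => if i.val + j.val + 1 = 1 then (1 : L) else 0)).Local v)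
    (a : LocalRing L v) (ha : εH.1.val.val = a • 1) (hu : εH.2.val.val 0 0 ≠ a) :
    ∃ (ε : (cmDatum L 3 H').Local v) (y : GL (Fin 3) (LocalRing L v))
      (θ : ((cmDatum L 2 (Matrix.of fun i j : Fin 2 => if i.val + j.val + 1 = 2 then (1 : L) else 0)).Local v ×
          (cmDatum L 1 (Matrix.of fun i j : Fin 1 => if i.val + j.val + 1 = 1 then (1 : L) else 0)).Local v) ≃ₜ*
        ↥(Subgroup.centralizer ({ε} : Set ((cmDatum L 3 H').Local v)))),
      IsLocalNormPair L H' v εH ε ∧ (θ εH).1 = ε ∧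
        ∀ z, (((θ z).1).val : GL (Fin 3) (LocalRing L v)) = y * ((endoEmbLocal L v z).val : GL (Fin 3) (LocalRing L v)) * y⁻¹ := by
  haveI : Algebra.IsQuadraticExtension ↥(maximalRealSubfield L) L := IsCMField.isQuadraticExtension L
  -- (1) the local congruence `U(Φ₃)(L⁺_v) ≅ U(H′)(L⁺_v)` from the rank-3 classification at the non-split place
  obtain ⟨T, a₀, ha₀, -, hT⟩ := exists_formCongr_map_eq_smul_antidiag_of_smul_eq L (IsCMField.complexConj L) (IsCMField.complexConj_ne_one L) H'
    ((map_cmConjRingHom_eq_map_complexConj L H') ▸ hH') hdet' w hw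
  let cT : (cmDatum L 3 (Matrix.of fun i j : Fin 3 => if i.val + j.val + 1 = 3 then (1 : L) else 0)).Local v ≃ₜ* (cmDatum L 3 H').Local v :=
    cmDatumLocalCongr L v T ha₀ hT
  -- (2) the composite embedding `f = c_T ∘ ι_v : H_v →* G′_v`
  let f : ((cmDatum L 2 (Matrix.of fun i j : Fin 2 => if i.val + j.val + 1 = 2 then (1 : L) else 0)).Local v ×
      (cmDatum L 1 (Matrix.of fun i j : Fin 1 => if i.val + j.val + 1 = 1 then (1 : L) else 0)).Local v) →* (cmDatum L 3 H').Local v :=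
    cT.toMonoidHom.comp (endoEmbLocal L v)
  have hf : ∀ z, f z = cT (endoEmbLocal L v z) := fun _ => rfl
  have hfval : ∀ z, ((f z).val : GL (Fin 3) (LocalRing L v)) = T * ((endoEmbLocal L v z).val : GL (Fin 3) (LocalRing L v)) * T⁻¹ :=
    fun z => coe_cmDatumLocalCongr_apply L v T ha₀ hT _
  have hind : IsInducing f := cT.toHomeomorph.isInducing.comp (isClosedEmbedding_endoEmbLocal L v).isInducing
  have hinj : Function.Injective f := cT.injective.comp (endoEmbLocal_injective L v)
  -- (3) `Z_{G′_v}(f ε_H) ⊆ range f`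
  have hsurj : ∀ g ∈ Subgroup.centralizer ({f εH} : Set ((cmDatum L 3 H').Local v)), g ∈ Set.range f := by
    intro g hg
    have hg' : cT.symm g ∈ Subgroup.centralizer ({endoEmbLocal L v εH} : Set _) := by
      rw [Subgroup.mem_centralizer_singleton_iff] at hg ⊢
      apply cT.injective
      rw [map_mul, map_mul, ContinuousMulEquiv.apply_symm_apply, ← hf, hg]
    obtain ⟨z, hz⟩ := mem_range_endoEmbLocal_of_mem_centralizer_of_fst_eq_smul_one L v w hw εH a ha hu hg'
    exact ⟨z, by rw [hf, hz, ContinuousMulEquiv.apply_symm_apply]⟩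
  -- (4) `Z_{H_v}(ε_H) ≃ₜ* Z_{G′_v}(f ε_H)`, and `Z_{H_v}(ε_H) = H_v`
  obtain ⟨e, he⟩ := exists_continuousMulEquiv_centralizer_of_isInducing f hind hinj εH hsurj
  have hcent : ∀ z, z ∈ Subgroup.centralizer ({εH} : Set _) :=
    fun z => Subgroup.mem_centralizer_singleton_iff.mpr (mul_comm_of_fst_eq_smul_one L v εH a ha z)
  let e₀ : ((cmDatum L 2 (Matrix.of fun i j : Fin 2 => if i.val + j.val + 1 = 2 then (1 : L) else 0)).Local v ×
      (cmDatum L 1 (Matrix.of fun i j : Fin 1 => if i.val + j.val + 1 = 1 then (1 : L) else 0)).Local v) ≃ₜ*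
      ↥(Subgroup.centralizer ({εH} : Set _)) :=
    { toFun := fun z => ⟨z, hcent z⟩
      invFun := fun z => z.1
      left_inv := fun _ => rfl
      right_inv := fun _ => rfl
      map_mul' := fun _ _ => rfl
      continuous_toFun := continuous_id.subtype_mk _
      continuous_invFun := continuous_subtype_val }
  refine ⟨f εH, T, e₀.trans e, ?_, ?_, fun z => ?_⟩
  · -- matching: `ι_v(ε_H)` and `ε = T ι_v(ε_H) T⁻¹` are conjugate in `GL₃`
    rw [isLocalNormPair_iff]
    exact isConj_iff.mpr ⟨T, hfval εH⟩
  · rw [ContinuousMulEquiv.trans_apply, he]; rfl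
  · rw [ContinuousMulEquiv.trans_apply, he]
    exact hfval z

end CM

end Literature.NumberTheory.Rogawski1990

end
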